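import Summits.AtomisticToContinuum.Crystallization.Theorems.PalmUnimodularRigidityLayeredLawsSelectHcpZeroStressSymmetry

/-!
# Crux `LayeredLawsSelectHcp` (stmt-AtomisticToContinuum-9226), line `mtp-prestress-split-ergodic-frame`:
# zero site stress kills the AFFINE part of the prestress term — for every matrix, no frame

Helper (`--supports stmt-AtomisticToContinuum-9226`) for the registered rigidity core `stub_hcpTubeRigidity` of
the checked skeleton `Cruxes/LayeredLawsSelectHcp/Lines/mtp_prestress_split_ergodic_frame.lean`, step (α) of its
FRAME-FREE mechanism (lead c1, cycle 2; memo `Cruxes/LayeredLawsSelectHcp/NOTES.md` §6a).  Expanding the mean root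
energy of an hcp-layered law in the SQUARED bond lengths `s_v = ‖b_v‖²` (`V_LJ(r) = W(r²)`, `W′ = ljSqDeriv`), the
first-order ("prestress") term is `Σ_v W′(s_v*) (E[s_v] − s_v*)`; its AFFINE part — `E[s_v]` replaced by a quadratic
form `y_vᵀ M y_v` of the reference site `y_v = hcpSite a h v`, e.g. `M = E[FᵀF]` for a (random, wandering) local
deformation gradient `F` — is `Σ_{l,m} M_lm S_lm` with `S` the squared-length site stress tensor `hcpSiteStress`, hence
ZERO at the relaxed reference by the landed `stub_zeroStress` (p91498), for EVERY matrix `M`: lengths see no rotation,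
so no global / ergodic frame has to be chosen (the card's invariant-frame Korn step is false for orientation-wandering
stationary laws; this identity is what replaces it at first order).

* `affinePrestress_vanishes` (REGISTERED sub-goal, proved): `S = 0 ⇒ Σ'_{v≠0} W′(‖y_v‖²)·(Σ_{l,m} M_lm (y_v)_l (y_v)_m) = 0`
  for every `M : Matrix (Fin 3) (Fin 3) ℝ` (swap the finite double sum with the absolutely convergent series,
  `summable_hcpStressTerm`, then each entry series is `M_lm · S_lm`).
* `cauchyBorn_firstOrder_vanishes`: the same with `Σ_{l,m} (FᵀF − 1)_lm (y_v)_l (y_v)_m = ‖F y_v‖² − ‖y_v‖²` for a matrix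
  `F` acting through `Matrix.toEuclideanLin` — the first variation of the Cauchy–Born energy of relaxed hcp vanishes in
  EVERY affine direction, compressions, shears and rotations alike.
All `[folklore]`; nothing here closes an item.
-/

noncomputable section

namespace Summit.AtomisticToContinuum.Crystallization.Theorems.PalmUnimodularRigidity.LayeredLawsSelectHcp

open Literature.MathematicalPhysics.StatisticalMechanics

/-- Pushing the indicator `[v ≠ 0]` and the weight `W′(‖y_v‖²)` through the finite double sum. [folklore] -/
theorem prestressTerm_matrix_expand (a h : ℝ) (M : Matrix (Fin 3) (Fin 3) ℝ) (v : ℤ × ℤ × ℤ) :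
    (if v = 0 then (0 : ℝ) else
        ljSqDeriv (‖hcpSite a h v‖ ^ 2) *
          ∑ l : Fin 3, ∑ m : Fin 3, M l m * (hcpSite a h v l * hcpSite a h v m)) =
      ∑ l : Fin 3, ∑ m : Fin 3, M l m *
        (if v = 0 then (0 : ℝ) else
          ljSqDeriv (‖hcpSite a h v‖ ^ 2) * (hcpSite a h v l * hcpSite a h v m)) := by
  split_ifs with hv
  · simp
  · rw [Finset.mul_sum]
    refine Finset.sum_congr rfl fun l _ => ?_
    rw [Finset.mul_sum]
    refine Finset.sum_congr rfl fun m _ => ?_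
    ring

/-- **Registered sub-goal `affinePrestress_vanishes` of crux stmt-AtomisticToContinuum-9226 (step (α) of the
frame-free mechanism of `stub_hcpTubeRigidity`): zero squared-length site stress kills the affine part of the
prestress term for EVERY matrix `M`** — `Σ'_{v ≠ 0} W′(‖y_v‖²) Σ_{l,m} M_lm (y_v)_l (y_v)_m = Σ_{l,m} M_lm S_lm = 0`.
No frame, no rotation, no symmetry of `M` is needed. [folklore] -/
theorem affinePrestress_vanishes : ∀ a h : ℝ, a ≠ 0 → h ≠ 0 →
    (∀ l m : Fin 3, hcpSiteStress a h l m = 0) → ∀ M : Matrix (Fin 3) (Fin 3) ℝ,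
      ∑' v : ℤ × ℤ × ℤ, (if v = 0 then (0 : ℝ) else
        ljSqDeriv (‖hcpSite a h v‖ ^ 2) *
          ∑ l : Fin 3, ∑ m : Fin 3, M l m * (hcpSite a h v l * hcpSite a h v m)) = 0 := by
  intro a h ha hh hS M
  rw [tsum_congr (prestressTerm_matrix_expand a h M)]
  have hsum : ∀ l m : Fin 3, Summable fun v : ℤ × ℤ × ℤ => M l m *
      (if v = 0 then (0 : ℝ) else
        ljSqDeriv (‖hcpSite a h v‖ ^ 2) * (hcpSite a h v l * hcpSite a h v m)) :=
    fun l m => (summable_hcpStressTerm ha hh l m).mul_left (M l m)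
  rw [Summable.tsum_finsetSum (fun l _ => summable_sum fun m _ => hsum l m)]
  refine Finset.sum_eq_zero fun l _ => ?_
  rw [Summable.tsum_finsetSum (fun m _ => hsum l m)]
  refine Finset.sum_eq_zero fun m _ => ?_
  rw [tsum_mul_left]
  have hSlm : hcpSiteStress a h l m = 0 := hS l m
  unfold hcpSiteStress at hSlm
  rw [hSlm, mul_zero]

/-- `‖F y‖² − ‖y‖²` as the quadratic form of `FᵀF − 1` (coordinates of `EuclideanSpace ℝ (Fin 3)`). [folklore] -/
theorem norm_sq_toEuclideanLin_sub (F : Matrix (Fin 3) (Fin 3) ℝ) (y : EuclideanSpace ℝ (Fin 3)) :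
    ‖Matrix.toEuclideanLin F y‖ ^ 2 - ‖y‖ ^ 2 =
      ∑ l : Fin 3, ∑ m : Fin 3, (F.transpose * F - 1) l m * (y l * y m) := by
  have h1 : ‖Matrix.toEuclideanLin F y‖ ^ 2 = ∑ i : Fin 3, (∑ m : Fin 3, F i m * y m) ^ 2 := by
    rw [EuclideanSpace.norm_sq_eq]
    refine Finset.sum_congr rfl fun i _ => ?_
    rw [Real.norm_eq_abs, sq_abs, Matrix.toLpLin_apply]
    rfl
  have h2 : ‖y‖ ^ 2 = ∑ i : Fin 3, y i ^ 2 := by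
    rw [EuclideanSpace.norm_sq_eq]
    refine Finset.sum_congr rfl fun i _ => ?_
    rw [Real.norm_eq_abs, sq_abs]
  rw [h1, h2]
  simp only [Matrix.sub_apply, Matrix.mul_apply, Matrix.transpose_apply, Matrix.one_apply,
    Fin.sum_univ_three]
  split_ifs <;> first | (exfalso; omega) | ring

/-- **First variation of the Cauchy–Born energy of zero-stress hcp vanishes in EVERY affine direction**:
`S = 0 ⇒ Σ'_{v≠0} W′(‖y_v‖²) (‖F y_v‖² − ‖y_v‖²) = 0` for every matrix `F` — the affine part of the frame-free
prestress term, with `M = FᵀF − 1` in `affinePrestress_vanishes`. [folklore] -/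
theorem cauchyBorn_firstOrder_vanishes {a h : ℝ} (ha : a ≠ 0) (hh : h ≠ 0)
    (hS : ∀ l m : Fin 3, hcpSiteStress a h l m = 0) (F : Matrix (Fin 3) (Fin 3) ℝ) :
    ∑' v : ℤ × ℤ × ℤ, (if v = 0 then (0 : ℝ) else
      ljSqDeriv (‖hcpSite a h v‖ ^ 2) *
        (‖Matrix.toEuclideanLin F (hcpSite a h v)‖ ^ 2 - ‖hcpSite a h v‖ ^ 2)) = 0 := by
  refine (tsum_congr fun v => ?_).trans (affinePrestress_vanishes a h ha hh hS (F.transpose * F - 1))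
  rw [norm_sq_toEuclideanLin_sub]

end Summit.AtomisticToContinuum.Crystallization.Theorems.PalmUnimodularRigidity.LayeredLawsSelectHcp

end
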